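import Summits.FinalStateConjecture.Statement
import Literature.Geometry.Lorentzian.CauchyDevelopmentConstSmul
import Literature.Geometry.Lorentzian.NullInfinityConstSmul
import Summits.FinalStateConjecture.FinalStateConjecture.Theorems.PhaseMixingCaptureCaptureSufficesDecompositionDilation
import Summits.FinalStateConjecture.FinalStateConjecture.Theorems.PhaseMixingCaptureCaptureSufficesStubScaleCovariance
import HarnessLib

set_option linter.dupNamespace false

/-!
# Stub `stub_scaleCovariance` of line `Sketch` of crux `CaptureSufficesC2`
# (stmt-FinalStateConjecture-14986, route `PhaseMixingCapture`): SCALE COVARIANCE of the settling clauses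

If `D' = (λ² h, λ k)` is the `λ`-dilate (`λ > 0`) of the vacuum datum `D = (h, k)` on `X` and every
maximal vacuum Cauchy development of `D'` has complete future null infinity and a sub-extremal
exhaustive `C²` final state decomposition of `O = J⁺(ι X) ∩ I⁻(charted)`, then so has every maximal
vacuum Cauchy development of `D`.

This registered stub is VERBATIM the registered Stub 5 of the predecessor crux `CaptureSuffices`
(stmt-FinalStateConjecture-9953, line `old-light-forces-soft-burial`), which is proved in the tree as
`…Theorems.CaptureSuffices.ScaleCovariance.stub_scaleCovariance`
(module `…Theorems.PhaseMixingCaptureCaptureSufficesStubScaleCovariance`): the dilate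
`(M, λ² g, τ, ι, λ⁻¹ ν)` of a maximal development `𝒟` of `D` (`VacuumCauchyDevelopment.constSmul`,
`isMaximal_constSmul`) is a maximal development of `D'`; complete `𝓘⁺` descends
(`hasCompleteFutureNullInfinity_of_constSmul`), the decomposition is transported along the chart
dilation (`exists_finalStateDecomposition_of_constSmul`), and `exteriorOf` is conformally invariant
(`causalFuture_constSmul`, `chronologicalPast_constSmul`). One proof serves both cruxes; this file
re-exports it under the C2 line's namespace. No definitions, no named facts.

References: Bartnik–Isenberg, *The constraint equations* (2004), §2 (scaling of the constraints);
Christodoulou, CQG 16 (1999) A23, pp. A26–A27; O'Neill 1983, Ch. 14.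
-/

noncomputable section

open scoped Manifold ContDiff

namespace Summit.FinalStateConjecture.FinalStateConjecture.Theorems.CaptureSufficesC2.Sketch

open Literature.Geometry.Lorentzian

/-- **Stub 5 of line `Sketch` (crux `CaptureSufficesC2`, stmt-FinalStateConjecture-14986) — SCALE
COVARIANCE of the settling clauses** (registered signature, verbatim). If `D' = (λ² h, λ k)` is the
`λ`-dilate of `D = (h, k)` (`λ > 0`) and every maximal vacuum Cauchy development of `D'` has complete
`𝓘⁺` and a sub-extremal exhaustive `C²` final state decomposition of `O = J⁺(ι X) ∩ I⁻(charted)`, then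
so has every maximal vacuum Cauchy development `𝒟` of `D`: the dilate `(M, λ² g, τ, ι, λ⁻¹ ν)` of `𝒟`
is a maximal vacuum Cauchy development of `D'`, the hypothesis applies to it, and its conclusions
descend along the dilation of the chart domains. This is the identical registered Stub 5 of the
predecessor crux stmt-FinalStateConjecture-9953, proved in the tree as
`CaptureSuffices.ScaleCovariance.stub_scaleCovariance`. Bartnik–Isenberg 2004, §2. [folklore] -/
theorem stub_scaleCovariance :
    ∀ (X : Type) [TopologicalSpace X] [ChartedSpace E3 X] [IsManifold (𝓡 3) ∞ X] [T2Space X]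
      [SecondCountableTopology X] [ConnectedSpace X] (D D' : InitialDataSet (𝓡 3) X) (lam : ℝ),
      0 < lam →
        ((∀ (x : X) (v w : TangentSpace (𝓡 3) x), D'.h.inner x v w = lam ^ 2 * D.h.inner x v w) ∧
          ∀ (x : X) (v w : TangentSpace (𝓡 3) x), D'.k x v w = lam * D.k x v w) →
        (∀ 𝒟 : VacuumCauchyDevelopment D', 𝒟.IsMaximal →
          Summit.FinalStateConjecture.HasCompleteNullInfinity 𝒟.toCauchyDevelopment ∧
            ∃ (O : Set 𝒟.carrier) (dec : FinalStateDecomposition 𝒟.toSpacetime O 2),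
              (∀ i, Kerr.IsSubextremal (dec.mass i) (dec.spin i)) ∧
                O = Summit.FinalStateConjecture.exteriorOf 𝒟.toCauchyDevelopment dec.charted ∧
                  Summit.FinalStateConjecture.HasExhaustiveCharts dec) →
        (∀ 𝒟 : VacuumCauchyDevelopment D, 𝒟.IsMaximal →
          Summit.FinalStateConjecture.HasCompleteNullInfinity 𝒟.toCauchyDevelopment ∧
            ∃ (O : Set 𝒟.carrier) (dec : FinalStateDecomposition 𝒟.toSpacetime O 2),
              (∀ i, Kerr.IsSubextremal (dec.mass i) (dec.spin i)) ∧
                O = Summit.FinalStateConjecture.exteriorOf 𝒟.toCauchyDevelopment dec.charted ∧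
                  Summit.FinalStateConjecture.HasExhaustiveCharts dec) :=
  CaptureSuffices.ScaleCovariance.stub_scaleCovariance

end Summit.FinalStateConjecture.FinalStateConjecture.Theorems.CaptureSufficesC2.Sketch

end
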